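import Summits.BirchSwinnertonDyer.BirchSwinnertonDyer.Theorems.AlignedTransportAtTwoMainConjectureOfRankZeroBSDAtTwoFineRoadRealKummerLinesLetterSwitchStratum
import HarnessLib

/-!
# THE STANDARD MODEL OF THE LETTER SWITCH: for the canonical parameters the switched `b`-invariants are those of an INTEGER model
# `[1, a₂, 0, a₄, a₆]` with ODD discriminant — every cell curve on the Kilford stratum has a letter switch with good reduction at `2`

Cell `bsd-f1-sign2`, WIDTH-5 attach seat `bsd-line-att-p5` (gen 15) on line `birth` of crux C2 stmt-BirchSwinnertonDyer-22298
`MainConjectureOfRankZeroBSDAtTwo`; fourth file of this gen's letter switch. `--supports 22298 --as helper`, bearing on crux C1 (stmt-22296,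
residual (R2) = Kilford stratum). HONEST FRAMING: THEOREMS ONLY — no definition, no named fact, no `sorry`; C1/C2-NEUTRAL; BSD is NOT proved by
any of this.

For `V` with integer `b`-invariants `B₂` (odd), `B₄`, `B₆`, `Δ(V) = D` odd, `c_V` split over `ℚ₂` (§2 of `…LetterSwitchStratum`: roots `y₁` unit,
`y₂, y₃` of norm `≤ 1/4` at distance `1/16`), and CANONICAL PARAMETERS `c₁` odd, `2⁹ ∣ c_V(c₁)`, `2⁸ ∥ ψ_V(c₃)` (§3 there: they exist):
* §1 `‖y₁ − c₁‖ ≤ 2⁻⁹`; `{‖y₂ − 4c₃‖, ‖y₃ − 4c₃‖} = {2⁻⁴, 2⁻⁸}`; images under `Q(u) = t(u − c₁)(u − 4c₃)/16`: norms `≤ 2⁻⁵`, `= 1`, `= 2⁻⁴`.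
* §2 the switched invariants (no shift, `t = ±1`): `‖b₂(W)‖₂ = 1`, `‖b₄(W)‖₂ = 1/2`, `‖b₆(W)‖₂ ≤ 1/32`, `‖c_V(−B₂ − c₁ − 4c₃)‖₂ = 2⁻¹²`;
  hence they are the `b`-invariants of an INTEGER model `M = [1, a₂, 0, a₄, a₆]` (for the right sign `t`) with `Δ(M) = D·(odd)²` ODD
  (`exists_int_model_letterSwitch`).
* (sequel `…LetterSwitchStandardModelExists`: the integer model `M = [1, a₂, 0, a₄, a₆]` with `2 ∤ Δ(M)` for EVERY such `V`, and its
  consequences — on the stratum, `E(ℚ)[2] = 0`, `Δ ∉ ℚ²`, and, when globally minimal, good ordinary at `2` and never `AlignedAtTwo` with `V`.)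

References: J. H. Silverman, *AEC* (2009) III.1, IV.§3, VII.1–VII.2; R. Greenberg, LNM 1716 §5 p. 174; K. Matsuno, IJNT 4 (2008) Thm. 4.2.
-/

set_option autoImplicit false
-- the Theorems namespace of this sub repeats the summit name by design (D-0017 nested layout)
set_option linter.dupNamespace false

noncomputable section

open scoped Classical

namespace Summit.BirchSwinnertonDyer.BirchSwinnertonDyer.Theorems.AlignedTransportAtTwoFineRoad.RealKummerLinesLetterSwitchStandardModel

open Polynomial WeierstrassCurve NumberField IsDedekindDomain Field Literature.NumberTheory.EllipticCurves
  Literature.NumberTheory.EllipticCurves.Greenberg1999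
  Summit.BirchSwinnertonDyer.Rank1Residual.F1Sign2
  Summit.BirchSwinnertonDyer.BirchSwinnertonDyer.Theorems.AlignedTransportAtTwoFineRoad
  Summit.BirchSwinnertonDyer.BirchSwinnertonDyer.Theorems.AlignedTransportAtTwoBridge
  Summit.BirchSwinnertonDyer.BirchSwinnertonDyer.Theorems.AlignedTransportAtTwoFineRoad.RealKummerLinesLetterSwitch
  Summit.BirchSwinnertonDyer.BirchSwinnertonDyer.Theorems.AlignedTransportAtTwoFineRoad.RealKummerLinesLetterSwitchStratum
  Summit.BirchSwinnertonDyer.Rank1Residual.X5.Instances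

/-! ## §1 The parameters against the roots -/

section Norms

variable {B₂ B₄ B₆ c₁ c₃ : ℤ} {y₁ y₂ y₃ : ℚ_[2]}

/-- An integer exactly divisible by `2⁸` has `2`-adic norm `2⁻⁸`. [folklore] -/
theorem norm_intCast_eq_of_dvd_of_not_dvd {k : ℤ} (h8 : (2 : ℤ) ^ 8 ∣ k) (h9 : ¬ (2 : ℤ) ^ 9 ∣ k) : ‖(k : ℚ_[2])‖ = (2 ^ 8 : ℝ)⁻¹ := by
  obtain ⟨j, rfl⟩ := h8
  have hj : ¬ 2 ∣ j := fun ⟨i, hi⟩ ↦ h9 ⟨i, by rw [hi]; ring⟩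
  rw [Int.cast_mul, Int.cast_pow, Int.cast_ofNat, norm_mul, RealKummerLinesPadicResidue.norm_two_pow 8,
    RealKummerLinesPadicLetter.norm_intCast_of_odd hj, mul_one]

/-- **`c₁` against the canonical root**: `‖y₁ − c₁‖ ≤ 2⁻⁹` from `2⁹ ∣ c_V(c₁)` (gen 14's residue certificate).
[cite: GreenbergLNM1716, §5 p. 174] [cite: SilvermanAEC2009, IV.§3, VII.2] -/
theorem norm_y₁_sub_c₁_le (hodd : ¬ 2 ∣ B₂) (hr₁ : y₁ ^ 3 + (B₂ : ℚ_[2]) * y₁ ^ 2 + 8 * (B₄ : ℚ_[2]) * y₁ + 16 * (B₆ : ℚ_[2]) = 0)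
    (h1 : ‖y₁‖ = 1) (hc₁ : ¬ 2 ∣ c₁) (h9 : (2 : ℤ) ^ 9 ∣ c₁ ^ 3 + B₂ * c₁ ^ 2 + 8 * B₄ * c₁ + 16 * B₆) :
    ‖y₁ - (c₁ : ℚ_[2])‖ ≤ (2 ^ 9 : ℝ)⁻¹ := by
  have hθ : 4 * (y₁ / 4) ^ 3 + (B₂ : ℚ_[2]) * (y₁ / 4) ^ 2 + 2 * (B₄ : ℚ_[2]) * (y₁ / 4) + (B₆ : ℚ_[2]) = 0 := by
    linear_combination hr₁ / 16
  have h4 : ‖y₁ / 4‖ = 4 := by rw [norm_div, h1, SignedKatoOffTwo.LocalTwo.padicNorm_four]; norm_num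
  have := RealKummerLinesPadicResidue.norm_four_mul_sub_intCast_le_of_dvd hodd hθ h4 hc₁ h9
  rwa [show (4 : ℚ_[2]) * (y₁ / 4) = y₁ by ring] at this

/-- **`c₃` against the non-canonical roots**: from `2⁸ ∥ ψ_V(c₃)`, `‖y₁‖ = 1`, `‖y₂ − y₃‖ = 1/16`:
`{‖y₂ − 4c₃‖, ‖y₃ − 4c₃‖} = {2⁻⁴, 2⁻⁸}`. [cite: SilvermanAEC2009, IV.§3, VII.2] -/
theorem norm_sub_four_c₃ (hw : ∀ z : ℚ_[2], z ^ 3 + (B₂ : ℚ_[2]) * z ^ 2 + 8 * (B₄ : ℚ_[2]) * z + 16 * (B₆ : ℚ_[2]) = (z - y₁) * (z - y₂) * (z - y₃))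
    (h1 : ‖y₁‖ = 1) (h23 : ‖y₂ - y₃‖ = 16⁻¹)
    (h8 : (2 : ℤ) ^ 8 ∣ 4 * c₃ ^ 3 + B₂ * c₃ ^ 2 + 2 * B₄ * c₃ + B₆) (h8' : ¬ (2 : ℤ) ^ 9 ∣ 4 * c₃ ^ 3 + B₂ * c₃ ^ 2 + 2 * B₄ * c₃ + B₆) :
    (‖y₂ - 4 * (c₃ : ℚ_[2])‖ = (2 ^ 4 : ℝ)⁻¹ ∧ ‖y₃ - 4 * (c₃ : ℚ_[2])‖ = (2 ^ 8 : ℝ)⁻¹) ∨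
      (‖y₃ - 4 * (c₃ : ℚ_[2])‖ = (2 ^ 4 : ℝ)⁻¹ ∧ ‖y₂ - 4 * (c₃ : ℚ_[2])‖ = (2 ^ 8 : ℝ)⁻¹) := by
  set m : ℚ_[2] := 4 * (c₃ : ℚ_[2]) with hm
  have hmle : ‖m‖ ≤ 4⁻¹ := by
    rw [hm, norm_mul, SignedKatoOffTwo.LocalTwo.padicNorm_four]
    exact (mul_le_mul_of_nonneg_left (Padic.norm_int_le_one _) (by norm_num)).trans (by norm_num)
  have hm1 : ‖m - y₁‖ = 1 := by
    rw [sub_eq_add_neg, Padic.add_eq_max_of_ne (by rw [norm_neg, h1]; exact (hmle.trans_lt (by norm_num)).ne), norm_neg, h1]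
    exact max_eq_right (hmle.trans (by norm_num))
  have hψ : (((4 * c₃ ^ 3 + B₂ * c₃ ^ 2 + 2 * B₄ * c₃ + B₆ : ℤ)) : ℚ_[2]) = ((16 : ℚ_[2]))⁻¹ * ((m - y₁) * (m - y₂) * (m - y₃)) := by
    rw [← hw m, hm]; push_cast; field_simp; ring
  have hprod : ‖m - y₂‖ * ‖m - y₃‖ = (2 ^ 12 : ℝ)⁻¹ := by
    have hn := norm_intCast_eq_of_dvd_of_not_dvd h8 h8'
    rw [hψ, norm_mul, norm_mul, norm_mul, hm1, one_mul, RealKummerLinesLetterSwitch.norm_inv_sixteen] at hn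
    nlinarith [hn]
  have e2 : ‖y₂ - 4 * (c₃ : ℚ_[2])‖ = ‖m - y₂‖ := by rw [← norm_neg, neg_sub]
  have e3 : ‖y₃ - 4 * (c₃ : ℚ_[2])‖ = ‖m - y₃‖ := by rw [← norm_neg, neg_sub]
  rw [e2, e3]
  rcases lt_trichotomy ‖m - y₂‖ ‖m - y₃‖ with h | h | h
  · -- `‖m − y₃‖` is the larger one: it equals `‖y₂ − y₃‖ = 2⁻⁴`
    right
    have key := Padic.add_eq_max_of_ne (show ‖m - y₃‖ ≠ ‖-(m - y₂)‖ by rw [norm_neg]; exact h.ne')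
    rw [show m - y₃ + -(m - y₂) = y₂ - y₃ by ring, norm_neg, max_eq_left h.le, h23] at key
    refine ⟨by rw [← key]; norm_num, ?_⟩
    rw [← key] at hprod; nlinarith [hprod]
  · exfalso
    have hsq : ‖m - y₃‖ * ‖m - y₃‖ = (2 ^ 12 : ℝ)⁻¹ := by rw [h] at hprod; exact hprod
    have h6 : ‖m - y₃‖ = (2 ^ 6 : ℝ)⁻¹ := by
      have h0 : 0 ≤ ‖m - y₃‖ := norm_nonneg _
      nlinarith [hsq, h0, sq_nonneg (‖m - y₃‖ - (2 ^ 6 : ℝ)⁻¹), sq_nonneg (‖m - y₃‖ + (2 ^ 6 : ℝ)⁻¹)]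
    have hle : ‖y₂ - y₃‖ ≤ (2 ^ 6 : ℝ)⁻¹ := by
      rw [show y₂ - y₃ = (m - y₃) + -(m - y₂) by ring]
      refine (Padic.nonarchimedean _ _).trans (max_le h6.le ?_)
      rw [norm_neg, h, h6]
    rw [h23] at hle; norm_num at hle
  · left
    have key := Padic.add_eq_max_of_ne (show ‖m - y₂‖ ≠ ‖-(m - y₃)‖ by rw [norm_neg]; exact h.ne')
    rw [show m - y₂ + -(m - y₃) = y₃ - y₂ by ring, norm_neg, max_eq_left h.le, norm_sub_rev, h23] at key
    refine ⟨by rw [← key]; norm_num, ?_⟩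
    rw [← key] at hprod; nlinarith [hprod]

/-- **Norms of the three images** under `Q(u) = t(u − c₁)(u − 4c₃)/16` (`t = ±1`): with `‖y₁ − c₁‖ ≤ 2⁻⁹`, `‖y₂ − 4c₃‖ = 2⁻⁴`, `‖y₃ − 4c₃‖ = 2⁻⁸`,
`‖y₁‖ = 1`, `‖y₂‖, ‖y₃‖ ≤ 1/4`, `c₁` odd: `‖Q(y₁)‖ ≤ 2⁻⁵`, `‖Q(y₂)‖ = 1`, `‖Q(y₃)‖ = 2⁻⁴` — the canonical root of `V` lands on a `2`-integral
abscissa, `Q(y₂)` becomes the canonical root of `W`. [cite: SilvermanAEC2009, IV.§3, VII.2] -/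
theorem norm_images {t : ℤ} (ht : t = 1 ∨ t = -1) (hc₁ : ¬ 2 ∣ c₁) (h1 : ‖y₁‖ = 1) (hy₂ : ‖y₂‖ ≤ 4⁻¹) (hy₃ : ‖y₃‖ ≤ 4⁻¹)
    (h9 : ‖y₁ - (c₁ : ℚ_[2])‖ ≤ (2 ^ 9 : ℝ)⁻¹) (h2c : ‖y₂ - 4 * (c₃ : ℚ_[2])‖ = (2 ^ 4 : ℝ)⁻¹) (h3c : ‖y₃ - 4 * (c₃ : ℚ_[2])‖ = (2 ^ 8 : ℝ)⁻¹) :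
    ‖(t : ℚ_[2]) * (y₁ - c₁) * (y₁ - 4 * c₃) / 16‖ ≤ (2 ^ 5 : ℝ)⁻¹ ∧ ‖(t : ℚ_[2]) * (y₂ - c₁) * (y₂ - 4 * c₃) / 16‖ = 1 ∧
      ‖(t : ℚ_[2]) * (y₃ - c₁) * (y₃ - 4 * c₃) / 16‖ = (2 ^ 4 : ℝ)⁻¹ := by
  have htn : ‖(t : ℚ_[2])‖ = 1 := by rcases ht with rfl | rfl <;> simp
  have hc : ‖(c₁ : ℚ_[2])‖ = 1 := RealKummerLinesPadicLetter.norm_intCast_of_odd hc₁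
  have h16 : ‖(16 : ℚ_[2])‖ = 16⁻¹ := RealKummerLinesPadicLetter.norm_sixteen
  have h4c : ‖4 * (c₃ : ℚ_[2])‖ ≤ 4⁻¹ := by
    rw [norm_mul, SignedKatoOffTwo.LocalTwo.padicNorm_four]
    exact (mul_le_mul_of_nonneg_left (Padic.norm_int_le_one _) (by norm_num)).trans (by norm_num)
  -- `‖y₁ − 4c₃‖ = 1`, `‖y₂ − c₁‖ = ‖y₃ − c₁‖ = 1`
  have hA : ‖y₁ - 4 * (c₃ : ℚ_[2])‖ = 1 := by
    rw [sub_eq_add_neg, Padic.add_eq_max_of_ne (by rw [norm_neg, h1]; exact (h4c.trans_lt (by norm_num)).ne'), h1, norm_neg]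
    exact max_eq_left (h4c.trans (by norm_num))
  have hB : ∀ y : ℚ_[2], ‖y‖ ≤ 4⁻¹ → ‖y - (c₁ : ℚ_[2])‖ = 1 := fun y hy ↦ by
    rw [sub_eq_add_neg, Padic.add_eq_max_of_ne (by rw [norm_neg, hc]; exact (hy.trans_lt (by norm_num)).ne), norm_neg, hc]
    exact max_eq_right (hy.trans (by norm_num))
  refine ⟨?_, ?_, ?_⟩
  · rw [norm_div, norm_mul, norm_mul, htn, hA, h16, one_mul, mul_one]
    calc ‖y₁ - (c₁ : ℚ_[2])‖ / 16⁻¹ ≤ (2 ^ 9 : ℝ)⁻¹ / 16⁻¹ := by gcongr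
      _ = (2 ^ 5 : ℝ)⁻¹ := by norm_num
  · rw [norm_div, norm_mul, norm_mul, htn, hB y₂ hy₂, h2c, h16]; norm_num
  · rw [norm_div, norm_mul, norm_mul, htn, hB y₃ hy₃, h3c, h16]; norm_num

end Norms

/-- `2ᵏ ∣ n` from `‖n‖₂ ≤ 2⁻ᵏ`. [folklore] -/
theorem two_pow_dvd_of_norm_le {n : ℤ} {k : ℕ} (h : ‖(n : ℚ_[2])‖ ≤ (2 ^ k : ℝ)⁻¹) : (2 : ℤ) ^ k ∣ n := by
  have h' : ‖(n : ℚ_[2])‖ ≤ ((2 : ℕ) : ℝ) ^ (-(k : ℕ) : ℤ) := by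
    rw [zpow_neg, zpow_natCast]; exact_mod_cast h
  exact_mod_cast (Padic.norm_int_le_pow_iff_dvd n k).mp h'

/-- `‖n‖₂ ≤ 2⁻ᵏ` from `2ᵏ ∣ n`. [folklore] -/
theorem norm_le_of_two_pow_dvd {n : ℤ} {k : ℕ} (h : (2 : ℤ) ^ k ∣ n) : ‖(n : ℚ_[2])‖ ≤ (2 ^ k : ℝ)⁻¹ := by
  have h' := (Padic.norm_int_le_pow_iff_dvd n k).mpr (by exact_mod_cast h)
  rw [zpow_neg, zpow_natCast] at h'; exact_mod_cast h'

/-! ## §2 The switched invariants for the canonical parameters: `2`-adic shape and the integer model -/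

section Invariants

variable {B₂ B₄ B₆ c₁ c₃ : ℤ} {y₁ y₂ y₃ : ℚ_[2]}

/-- **`2`-adic shape of the switched `b`-invariants** (canonical parameters, no shift, `t = ±1`): `‖b₂(W)‖ = 1`, `‖b₄(W)‖ = 1/2`,
`‖b₆(W)‖ ≤ 1/32`, and `‖c_V(−B₂ − c₁ − 4c₃)‖ = 2⁻¹²` (so `Δ(W) = Δ(V)·(c_V(−B₂−c₁−4c₃)/4096)²` is a `2`-adic unit times `Δ(V)`).
[cite: SilvermanAEC2009, III.1, IV.§3, VII.2] -/
theorem norm_switched_invariants {t : ℤ} (ht : t = 1 ∨ t = -1) (hc₁ : ¬ 2 ∣ c₁)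
    (hw : ∀ z : ℚ_[2], z ^ 3 + (B₂ : ℚ_[2]) * z ^ 2 + 8 * (B₄ : ℚ_[2]) * z + 16 * (B₆ : ℚ_[2]) = (z - y₁) * (z - y₂) * (z - y₃))
    (h1 : ‖y₁‖ = 1) (hy₂ : ‖y₂‖ ≤ 4⁻¹) (hy₃ : ‖y₃‖ ≤ 4⁻¹)
    (h9 : ‖y₁ - (c₁ : ℚ_[2])‖ ≤ (2 ^ 9 : ℝ)⁻¹) (h2c : ‖y₂ - 4 * (c₃ : ℚ_[2])‖ = (2 ^ 4 : ℝ)⁻¹) (h3c : ‖y₃ - 4 * (c₃ : ℚ_[2])‖ = (2 ^ 8 : ℝ)⁻¹)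
    {P₂ P₄ P₆ : ℚ} (hP₂ : P₂ = (t : ℚ) / 16 * (16 * B₄ - B₂ ^ 2 - B₂ * c₁ - 4 * B₂ * c₃ - 12 * c₁ * c₃))
    (hP₄ : P₄ = (6 * (c₁ : ℚ) ^ 2 * c₃ ^ 2 + 4 * B₂ * c₁ * c₃ ^ 2 + B₂ * c₁ ^ 2 * c₃ + B₂ ^ 2 * c₁ * c₃ + 16 * B₄ * c₃ ^ 2
        - 8 * B₄ * c₁ * c₃ + B₄ * c₁ ^ 2 + 4 * B₂ * B₄ * c₃ + B₂ * B₄ * c₁ - 24 * B₆ * c₃ - 6 * B₆ * c₁ + 8 * B₄ ^ 2 - 4 * B₂ * B₆) / 256)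
    (hP₆ : P₆ = -(t : ℚ) / 4096 * ((c₁ : ℚ) ^ 3 + B₂ * c₁ ^ 2 + 8 * B₄ * c₁ + 16 * B₆) * (4 * (c₃ : ℚ) ^ 3 + B₂ * c₃ ^ 2 + 2 * B₄ * c₃ + B₆)) :
    ‖(P₂ : ℚ_[2])‖ = 1 ∧ ‖(P₄ : ℚ_[2])‖ = 2⁻¹ ∧ ‖(P₆ : ℚ_[2])‖ ≤ (2 ^ 5 : ℝ)⁻¹ ∧
      ‖(((-B₂ - c₁ - 4 * c₃) ^ 3 + B₂ * (-B₂ - c₁ - 4 * c₃) ^ 2 + 8 * B₄ * (-B₂ - c₁ - 4 * c₃) + 16 * B₆ : ℤ) : ℚ_[2])‖ = (2 ^ 12 : ℝ)⁻¹ := by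
  obtain ⟨hQ₁, hQ₂, hQ₃⟩ := norm_images ht hc₁ h1 hy₂ hy₃ h9 h2c h3c
  set Q₁ : ℚ_[2] := (t : ℚ_[2]) * (y₁ - c₁) * (y₁ - 4 * c₃) / 16 with hq₁
  set Q₂ : ℚ_[2] := (t : ℚ_[2]) * (y₂ - c₁) * (y₂ - 4 * c₃) / 16 with hq₂
  set Q₃ : ℚ_[2] := (t : ℚ_[2]) * (y₃ - c₁) * (y₃ - 4 * c₃) / 16 with hq₃
  -- Vieta for the switched cubic over `ℚ₂`
  have hV : ∀ z : ℚ_[2], z ^ 3 + ((B₂ : ℚ) : ℚ_[2]) * z ^ 2 + 8 * ((B₄ : ℚ) : ℚ_[2]) * z + 16 * ((B₆ : ℚ) : ℚ_[2]) = (z - y₁) * (z - y₂) * (z - y₃) := by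
    intro z; rw [Rat.cast_intCast, Rat.cast_intCast, Rat.cast_intCast]; exact hw z
  have hWz := cW_eq_prod_of_cV_eq_prod (K := ℚ_[2]) (b₂ := (B₂ : ℚ)) (b₄ := (B₄ : ℚ)) (b₆ := (B₆ : ℚ)) (B₂ := P₂) (B₄ := P₄)
    (B₆ := P₆) (c₁ := c₁) (c₃ := c₃) (r := 0) ht (by rw [hP₂]; push_cast; ring) (by rw [hP₄]; push_cast; ring)
    (by rw [hP₆]; push_cast; ring) hV
  have f₁ : (P₂ : ℚ_[2]) = -(Q₁ + Q₂ + Q₃) := by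
    have h := (hWz 1); have h' := hWz (-1); have h0 := hWz 0
    rw [hq₁, hq₂, hq₃]; push_cast at h h' h0 ⊢; linear_combination (h + h' - 2 * h0) / 2
  have f₂ : (P₄ : ℚ_[2]) = (Q₁ * Q₂ + Q₁ * Q₃ + Q₂ * Q₃) / 8 := by
    have h := (hWz 1); have h' := hWz (-1)
    rw [hq₁, hq₂, hq₃]; push_cast at h h' ⊢; linear_combination (h - h') / 16
  have f₃ : (P₆ : ℚ_[2]) = -(Q₁ * Q₂ * Q₃) / 16 := by
    have h0 := hWz 0
    rw [hq₁, hq₂, hq₃]; push_cast at h0 ⊢; linear_combination h0 / 16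
  have h8 : ‖(8 : ℚ_[2])‖ = 8⁻¹ := DepletionAtTwo.norm_eight_padic_two
  have h16 : ‖(16 : ℚ_[2])‖ = 16⁻¹ := RealKummerLinesPadicLetter.norm_sixteen
  refine ⟨?_, ?_, ?_, ?_⟩
  · -- `Q₂` dominates
    have hsmall : ‖Q₁ + Q₃‖ < ‖Q₂‖ := by
      rw [hQ₂]; exact (Padic.nonarchimedean _ _).trans_lt (max_lt (hQ₁.trans_lt (by norm_num)) (by rw [hQ₃]; norm_num))
    rw [f₁, norm_neg, show Q₁ + Q₂ + Q₃ = Q₂ + (Q₁ + Q₃) by ring, Padic.add_eq_max_of_ne hsmall.ne', max_eq_left hsmall.le, hQ₂]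
  · have hbig : ‖Q₂ * Q₃‖ = (2 ^ 4 : ℝ)⁻¹ := by rw [norm_mul, hQ₂, hQ₃, one_mul]
    have hsmall : ‖Q₁ * Q₂ + Q₁ * Q₃‖ < ‖Q₂ * Q₃‖ := by
      rw [hbig]
      refine (Padic.nonarchimedean _ _).trans_lt (max_lt ?_ ?_)
      · rw [norm_mul, hQ₂, mul_one]; exact hQ₁.trans_lt (by norm_num)
      · rw [norm_mul, hQ₃]; nlinarith [hQ₁, norm_nonneg Q₁]
    rw [f₂, norm_div, h8, show Q₁ * Q₂ + Q₁ * Q₃ + Q₂ * Q₃ = Q₂ * Q₃ + (Q₁ * Q₂ + Q₁ * Q₃) by ring,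
      Padic.add_eq_max_of_ne hsmall.ne', max_eq_left hsmall.le, hbig]
    norm_num
  · rw [f₃, norm_div, norm_neg, norm_mul, norm_mul, hQ₂, hQ₃, h16]
    have h0 := norm_nonneg Q₁
    calc ‖Q₁‖ * 1 * (2 ^ 4 : ℝ)⁻¹ / 16⁻¹ = ‖Q₁‖ := by ring
      _ ≤ (2 ^ 5 : ℝ)⁻¹ := hQ₁
  · -- `c_V(m) = (m − y₁)(m − y₂)(m − y₃)` with `m = −B₂ − c₁ − 4c₃ = (y₁ + y₂ + y₃) − c₁ − 4c₃`
    have e₁ : (B₂ : ℚ_[2]) = -(y₁ + y₂ + y₃) := by linear_combination (hw 1 + hw (-1) - 2 * hw 0) / 2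
    have hm := hw ((-B₂ - c₁ - 4 * c₃ : ℤ) : ℚ_[2])
    have hcast : (((-B₂ - c₁ - 4 * c₃) ^ 3 + B₂ * (-B₂ - c₁ - 4 * c₃) ^ 2 + 8 * B₄ * (-B₂ - c₁ - 4 * c₃) + 16 * B₆ : ℤ) : ℚ_[2]) =
        ((y₂ - c₁) + (y₃ - 4 * c₃)) * ((y₁ - c₁) + (y₃ - 4 * c₃)) * ((y₁ - c₁) + (y₂ - 4 * c₃)) := by
      push_cast at hm ⊢
      rw [hm, e₁]; ring
    have hc : ‖(c₁ : ℚ_[2])‖ = 1 := RealKummerLinesPadicLetter.norm_intCast_of_odd hc₁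
    have hB : ‖y₂ - (c₁ : ℚ_[2])‖ = 1 := by
      rw [sub_eq_add_neg, Padic.add_eq_max_of_ne (by rw [norm_neg, hc]; exact (hy₂.trans_lt (by norm_num)).ne), norm_neg, hc]
      exact max_eq_right (hy₂.trans (by norm_num))
    have n1 : ‖(y₂ - c₁) + (y₃ - 4 * (c₃ : ℚ_[2]))‖ = 1 := by
      rw [Padic.add_eq_max_of_ne (by rw [hB, h3c]; norm_num), hB, h3c]; norm_num
    have n2 : ‖(y₁ - c₁) + (y₃ - 4 * (c₃ : ℚ_[2]))‖ = (2 ^ 8 : ℝ)⁻¹ := by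
      rw [Padic.add_eq_max_of_ne (by rw [h3c]; exact (h9.trans_lt (by norm_num)).ne), h3c]
      exact max_eq_right (h9.trans (by norm_num))
    have n3 : ‖(y₁ - c₁) + (y₂ - 4 * (c₃ : ℚ_[2]))‖ = (2 ^ 4 : ℝ)⁻¹ := by
      rw [Padic.add_eq_max_of_ne (by rw [h2c]; exact (h9.trans_lt (by norm_num)).ne), h2c]
      exact max_eq_right (h9.trans (by norm_num))
    rw [hcast, norm_mul, norm_mul, n1, n2, n3]; norm_num

end Invariants

end Summit.BirchSwinnertonDyer.BirchSwinnertonDyer.Theorems.AlignedTransportAtTwoFineRoad.RealKummerLinesLetterSwitchStandardModel
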